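import Summits.ABC.IUTFork.Thm311RealInd1StripPacketStrictnessDyadic
import Summits.ABC.IUTFork.Thm311RealInd1StripHullDyadic
import Summits.ABC.IUTFork.Thm311RealInd1StripPacketDualBoxVolumePerImage
import HarnessLib

/-!
# [IUTchIII] Thm 3.11 (i) (Ind1)+(Ind2) ⟶ Cor 3.12 at the prime `2`, reading (P), over an all-`ℚ₂(√−1)` place section: the prime-level dichotomy
# of the tame rows DEGENERATES — `ln ν̄_{𝕃_2}` of reading (P) over ANY factorwise-strip `H ≤ indTwo` is STRICTLY below the Dupuy–Hilado
# container's `−|log(Θ)|^{(P)}_2`, for EVERY Θ-idele (UNCONDITIONAL; no room condition, no Jannsen–Wingberg / Diekert–Nishio binder)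

PROOF-ONLY file (abc-iut cell, Cor. 3.12 sub-crew, seat abc-iut-c312-1 = holder of record of the typed [IUTchIII] Thm. 3.11, gen 27; row
«C:P2-PRIME-DICHOTOMY ⟹ STRICTNESS», file 3/3, over file 2/3 `Thm311RealInd1StripPacketStrictnessDyadic` (trace ceiling + packet log-volume gap at an
all-`ℚ₂(√−1)` packet), gen 24's `Thm311RealInd1StripHullDyadic` §5 (`√−1 ∈ K`, local degree `2` ⟹ `(e, f) = (2, 1)`), gen 21's
`Thm311RealInd1StripPacketDualBoxVolumePerImage` (quantitative monotonicity `lnνLp_le_sub_of_succ`) and abc-iut-s2's content bookkeeping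
`GenuineLogThetaPerImageExactVolume` / `…SubIndeterminacy`).  TAKES NO SIDE on [IUTchIII] Cor. 3.12.  No definition, no `Prop` fact, no instance,
no notation.

SETTING.  The real prime packet `Q = realPrimePacketWith 2 (σ.localFields 2) c` over the GENUINE completions `K_{v̲}` of a place section `σ : V(F₀) → V(K)`
(any shell normalisation `c`); `K ∋ s` with `s² = −1` (for genuine initial Θ-data `√−1 ∈ F ⊆ K`, [IUTchI] Def. 3.1 (a)) and EVERY place `v̲` of the
section over `2` of local degree `2` — so `K_{v̲} ≅ ℚ₂(√−1)`, `(e, f) = (2, 1)`, `log₂(𝒪^×) = 𝔪³`; a `2`-local Θ-idele `t = (t_{i,v})` (ANY); a family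
`H = (H_{j,v⃗})` of subgroups of the packet automorphisms with `H_{j,v⃗} ≤ indTwo` (the Dupuy–Hilado container) acting on pure tensors factorwise through
the additive closures of the realised (Ind1) strip groups — the class of R28–R32's prime-level rows WITHOUT the «contains the strip moves» clause (only
the upper bound is needed here).  Every collection `v⃗ ∈ V(F₀)_2^{j+1}`, `j = i+1 ≥ 1`, has at least two slots.
* §1 **`localFields_packetHull_orbitH_pilotRegion_ne_slotImagesHull_of_dyadicSqrtNegOne`** — at EVERY collection the hull of the `H`-orbit of
  `O_𝕃(−P_Θ)_{v⃗} = ι_j(t_{i,v_j})·(R_I)^∼` is NOT the slot-image hull: the left side of R30 §1's displayed iff FAILS identically at `p = 2` (file 2/3 at the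
  content of the Θ-region, abc-iut-s2 `realPrimePacketWith_exists_content_logμ_slotImagesHull`);
* §2 **`localFields_lnνLp_hull_orbitH_le_negLogThetaPerImageAt_sub_of_dyadicSqrtNegOne`** — `ln ν̄_{𝕃_2}(v⃗ ↦ hull(⋃_{g∈H_{v⃗}} g(O_𝕃(−P_Θ)_{v⃗}))) ≤
  −|log(Θ)|^{(P)}_2 − (1/ℓ⋆)·((Σ_j f(L_j)/D)·log 2)·Π_b Pr(v_{1,b})` at any chosen collection `v⃗₁` where `H` acts factorwise-strip;
  **`localFields_lnνLp_hull_orbitH_lt_negLogThetaPerImageAt_of_dyadicSqrtNegOne`** and **`…_ne_negLogThetaPerImageAt_of_dyadicSqrtNegOne`** (`ℓ⋆ ≥ 1`): for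
  EVERY Θ-idele `t`, `ln ν̄_{𝕃_2}(reading (P) over H) < −|log(Θ)|^{(P)}_2` — R30 §2's «⟹» branch at `p = 2` with the room hypothesis GONE and no bit oracle.
READING (numbers about OUR typed objects; neutral): over a field `K ∋ √−1` and a section all of whose places over `2` have local degree `2`, the
`p = 2` summand of the Θ-side of [IUTchIII] Cor. 3.12 computed over print's (Ind1)⊔(Ind2) AS TYPED (any factorwise-strip `H ≤ indTwo`) is STRICTLY
below the Dupuy–Hilado number `−|log(Θ)|^{(P)}_2` for every Θ-idele — so, by R32's localisation (`2 ∈ T(I) ∖ P` always,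
`Thm311RealInd1StripGlobalDichotomy`) and R31/R32's prime-by-prime criterion, the GLOBAL identity «Θ-side over H = Dupuy–Hilado's −|log(Θ)|^{(P)}»
FAILS AS TYPED for every such datum, whatever happens at the odd primes; with abc-iut-c312-d1's monotonicity (always `≤`) [IUTchIII] Cor. 3.12 in
reading (P) over such an `H` is STRICTLY HARDER than over the container at `2`.  HONEST SCOPE: OUR typings (THE equivariant lift, THE logarithm,
factorwise action; F-B28-1 untouched); all places of the section over `2` of type `ℚ₂(√−1)` (dyadic local degree `≥ 4` and mixed dyadic packets NOT
treated); reading (P) only (the (U) twin over `possibleImagesHull` is the successor's); nothing about print's indeterminacies beyond the typed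
(Ind1)⊔(Ind2); equal-AS-TYPED ≠ equal in print; calibrates `stub_cor312PerImage` at the `p = 2` residual, discharges nothing; nothing here asserts that
abc is proved or refuted; no side taken on [IUTchIII] Cor. 3.12 / [IUTchIV] Thm. 1.10, on (U) vs (P), or on any author. [claim: Mochizuki2012, status:
disputed]; [cite: Mochizuki2012, IUTchI Def. 3.1 (a)(e) pp. 61–62; IUTchIII Thm. 3.11 (i) (Ind1)(Ind2) p. 154; Rmk. 3.9.5 (i) p. 127; Cor. 3.12 p. 174,
proof Step (x) p. 181, Step (xi) p. 183; IUTchIV Prop. 1.1 p. 9, Prop. 1.4 (i)(iii) p. 13]; [cite: HoshiNishio2022OuterAutMLF, Lemma 2.3 (ii) p. 7];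
[cite: DupuyHilado2025, Def. 3.6.1, Def. 3.6.3, §3.7, §3.9, §4.9, §4.12]; [cite: NeukirchANT1999, Ch. II Prop. (5.7), (6.8)]. typed ≠ proved; located ≠
adjudicated.
-/

set_option autoImplicit false

noncomputable section

open Metric Set Function Module Bornology
open scoped Pointwise TensorProduct

namespace Summit.ABC.IUTFork.Thm311.Real

open NumberField IsDedekindDomain Literature.NumberTheory.NumberFields Literature.IUT.LogVolume
open Literature.NumberTheory.GaloisRepresentations Literature.NumberTheory.GaloisRepresentations.Ultrametric
open Literature.AnabelianGeometry.AbsoluteAnabelian Literature.IUT.HodgeArakelov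
open Literature.IUT.HodgeArakelov.AbsTopMonoids Literature.IUT.LogThetaLattice
open Literature.IUT.LogVolume.TraceZeroDyadicSqrtNegOne

/-! ## §1–§2 The genuine place-section packets at `p = 2`: reading (P) over a factorwise-strip `H` is STRICTLY below `−|log(Θ)|^{(P)}_2` -/

section PlaceSection

variable {F₀ : Type} [Field F₀] [NumberField F₀] {K : Type} [Field K] [NumberField K] [Algebra F₀ K]
variable (σ : PlaceSection F₀ K)
variable (c : (j : ℕ) → (Fin (j + 1) → placesOver F₀ 2) → ℚ_[2]) (hc0 : ∀ j e, c j e ≠ 0)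
  (hcσ : ∀ (j : ℕ) (τ : Equiv.Perm (Fin (j + 1))) (e : Fin (j + 1) → placesOver F₀ 2), c j (e ∘ τ) = c j e)

/-- In a collection of `j + 2` slots the first and the last slot differ. [cite: DupuyHilado2025, Def. 3.6.1] -/
private theorem zero_ne_last (n : ℕ) : (0 : Fin (n + 1 + 1)) ≠ Fin.last (n + 1) := by
  intro h
  have h' := congrArg Fin.val h
  rw [Fin.val_zero, Fin.val_last] at h'
  omega

/-- **AT EVERY ALL-`ℚ₂(√−1)` COLLECTION THE `H`-ORBIT HULL OF THE Θ-REGION IS NOT THE SLOT-IMAGE HULL** (UNCONDITIONAL).  Real prime packet over the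
genuine completions of a place section (any shell `c`), `K ∋ s` with `s² = −1`, every place of the section over `2` of local degree `2`; Θ-idele `t`,
degree `j = i+1`, collection `v⃗ = e`; `H ≤ indTwo` acting factorwise through the realised strip groups.  Then
`packetHull(⋃_{g∈H} g(O_𝕃(−P_Θ)_{v⃗})) ≠ slotImagesHull(O_𝕃(−P_Θ))_{v⃗}` — the left side of R30 §1's displayed iff FAILS at `p = 2`, whatever `t`
(file 2/3 §3 at the content of the Θ-region, abc-iut-s2 `realPrimePacketWith_exists_content_logμ_slotImagesHull`). [claim: Mochizuki2012, status: disputed]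
[cite: Mochizuki2012, IUTchI Def. 3.1 (a)(e) pp. 61–62; IUTchIII Thm. 3.11 (i) p. 154; Cor. 3.12 proof Step (x) p. 181, Step (xi) p. 183]
[cite: DupuyHilado2025, §3.9, §4.9, §4.12] [cite: NeukirchANT1999, Ch. II Prop. (5.7), (6.8)] -/
theorem localFields_packetHull_orbitH_pilotRegion_ne_slotImagesHull_of_dyadicSqrtNegOne {s : K} (hs : s ^ 2 = -1)
    (hd : ∀ w : placesOver F₀ 2, localDeg K (σ.lift w.1) = 2) {lstar : ℕ}
    (t : Fin lstar → (v : placesOver F₀ 2) → ((σ.localFields 2).k v)ˣ) (i : Fin lstar)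
    (e : Fin ((i : ℕ) + 1 + 1) → placesOver F₀ 2)
    (H : Subgroup (PacketAlgebra 2 (fun b => (σ.localFields 2).k (e b)) ≃ₗ[ℚ_[2]]
      PacketAlgebra 2 (fun b => (σ.localFields 2).k (e b))))
    (hH : H ≤ indTwo 2 (fun b => (σ.localFields 2).k (e b)))
    (hHfac : ∀ γ ∈ H, ∃ δ : Π b, AddAut ((σ.lift (e b).1).adicCompletion K),
      (∀ b, δ b ∈ AddSubgroup.closure (G := AddAut ((σ.lift (e b).1).adicCompletion K))
        (ind1StripOf (σ.lift (e b).1) (galoisLog (σ.lift (e b).1)))) ∧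
      ∀ z : Π b, (σ.localFields 2).k (e b),
        (γ : PacketAlgebra 2 (fun b => (σ.localFields 2).k (e b)) ≃ₗ[ℚ_[2]]
            PacketAlgebra 2 (fun b => (σ.localFields 2).k (e b))) (PiTensorProduct.tprod ℚ_[2] z) =
          PiTensorProduct.tprod ℚ_[2] (fun b => RescaledCompletion.of K 2 (σ.lift (e b).1) (σ.natCast_mem_lift (e b))
            (δ b ((RescaledCompletion.of K 2 (σ.lift (e b).1) (σ.natCast_mem_lift (e b))).symm (z b))))) :
    packetHull 2 (fun b => (σ.localFields 2).k (e b))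
        (⋃ γ : H, (γ : PacketAlgebra 2 (fun b => (σ.localFields 2).k (e b)) ≃ₗ[ℚ_[2]]
            PacketAlgebra 2 (fun b => (σ.localFields 2).k (e b))) ''
          (realPrimePacketWith 2 (σ.localFields 2) c hc0 hcσ).pilotRegion t ((i : ℕ) + 1) e) ≠
      (realPrimePacketWith 2 (σ.localFields 2) c hc0 hcσ).slotImagesHull
        ((realPrimePacketWith 2 (σ.localFields 2) c hc0 hcσ).pilotRegion t) ((i : ℕ) + 1) e := by
  -- the per-factor data of the dyadic shape
  have hι : ∀ b, (RescaledCompletion.of K 2 (σ.lift (e b).1) (σ.natCast_mem_lift (e b))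
      (algebraMap K ((σ.lift (e b).1).adicCompletion K) s)) ^ 2 = -1 :=
    fun b => sq_of_algebraMap_eq_neg_one' (σ.lift (e b).1) (σ.natCast_mem_lift (e b)) hs
  have hef := fun b => absRamificationIdx_eq_two_and_residueDegree_eq_one_of_localDeg_eq_two (σ.lift (e b).1)
    (σ.natCast_mem_lift (e b)) (hι b) (hd (e b))
  have hϖex := fun b => exists_isUniformizer (F := (σ.localFields 2).k (e b))
  choose ϖ hϖ using hϖex
  obtain ⟨m, hm, -, hhull, -, -⟩ := realPrimePacketWith_exists_content_logμ_slotImagesHull 2 (σ.localFields 2) c hc0 hcσ t i e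
  rw [hhull, realPrimePacketWith_pilotRegion_succ_eq]
  exact packetHull_orbitH_ne_container_of_dyadicSqrtNegOne (fun b => σ.lift (e b).1) (fun b => σ.natCast_mem_lift (e b)) hι
    (fun b => (hef b).1) (fun b => (hef b).2) hϖ (zero_ne_last i) H hH hHfac (zpow_ne_zero m (by norm_num)) hm

/-- **READING (P) AT `p = 2`: STRICTLY BELOW `−|log(Θ)|^{(P)}_2` BY AN EXPLICIT MARGIN (UNCONDITIONAL, NO ROOM CONDITION).**  Real prime packet over
the genuine completions of a place section (any shell `c`), `K ∋ s` with `s² = −1`, every place of the section over `2` of local degree `2` (so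
`K_{v̲} ≅ ℚ₂(√−1)` there), Θ-idele `t`, family `H = (H_{j,v⃗})` of subgroups of the container `indTwo`; if at ONE degree `j₁ = i₁+1 ≤ ℓ⋆` and ONE
collection `v⃗₁ = e₁` the group `H_{j₁,v⃗₁}` acts factorwise through the realised strip groups, then
`ln ν̄_{𝕃_2}(v⃗ ↦ hull(⋃_{g∈H_{v⃗}} g(O_𝕃(−P_Θ)_{v⃗}))) ≤ −|log(Θ)|^{(P)}_2 − (1/ℓ⋆)·((Σ_j f(L_j)/D)·log 2)·Π_b Pr(v_{1,b})` (file 2/3 §3 at the content of the Θ-region +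
abc-iut-c312-d1's summandwise monotonicity, gen 21 `lnνLp_le_sub_of_succ`) — R30 §2's strict branch at `p = 2` WITHOUT any room hypothesis.
[claim: Mochizuki2012, status: disputed] [cite: Mochizuki2012, IUTchI Def. 3.1 (a)(e) pp. 61–62; IUTchIII Thm. 3.11 (i) p. 154; Cor. 3.12 proof
Step (x) p. 181; IUTchIV Prop. 1.4 (iii) p. 13] [cite: DupuyHilado2025, Def. 3.6.3, §3.9, §4.9, §4.12] [cite: NeukirchANT1999, Ch. II Prop. (5.7), (6.8)] -/
theorem localFields_lnνLp_hull_orbitH_le_negLogThetaPerImageAt_sub_of_dyadicSqrtNegOne {s : K} (hs : s ^ 2 = -1)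
    (hd : ∀ w : placesOver F₀ 2, localDeg K (σ.lift w.1) = 2) {lstar : ℕ}
    (t : Fin lstar → (v : placesOver F₀ 2) → ((σ.localFields 2).k v)ˣ)
    (H : (j : ℕ) → (e : Fin (j + 1) → placesOver F₀ 2) →
      Subgroup (PacketAlgebra 2 (fun b => (σ.localFields 2).k (e b)) ≃ₗ[ℚ_[2]]
        PacketAlgebra 2 (fun b => (σ.localFields 2).k (e b))))
    (hH : ∀ j e, H j e ≤ indTwo 2 (fun b => (σ.localFields 2).k (e b)))
    (i₁ : Fin lstar) (e₁ : Fin ((i₁ : ℕ) + 1 + 1) → placesOver F₀ 2)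
    (hHfac : ∀ γ ∈ H ((i₁ : ℕ) + 1) e₁, ∃ δ : Π b, AddAut ((σ.lift (e₁ b).1).adicCompletion K),
      (∀ b, δ b ∈ AddSubgroup.closure (G := AddAut ((σ.lift (e₁ b).1).adicCompletion K))
        (ind1StripOf (σ.lift (e₁ b).1) (galoisLog (σ.lift (e₁ b).1)))) ∧
      ∀ z : Π b, (σ.localFields 2).k (e₁ b),
        (γ : PacketAlgebra 2 (fun b => (σ.localFields 2).k (e₁ b)) ≃ₗ[ℚ_[2]]
            PacketAlgebra 2 (fun b => (σ.localFields 2).k (e₁ b))) (PiTensorProduct.tprod ℚ_[2] z) =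
          PiTensorProduct.tprod ℚ_[2] (fun b => RescaledCompletion.of K 2 (σ.lift (e₁ b).1) (σ.natCast_mem_lift (e₁ b))
            (δ b ((RescaledCompletion.of K 2 (σ.lift (e₁ b).1) (σ.natCast_mem_lift (e₁ b))).symm (z b))))) :
    (realPrimePacketWith 2 (σ.localFields 2) c hc0 hcσ).lnνLp lstar (fun j e =>
        packetHull 2 (fun b => (σ.localFields 2).k (e b))
          (⋃ g : H j e, (g : PacketAlgebra 2 (fun b => (σ.localFields 2).k (e b)) ≃ₗ[ℚ_[2]]
              PacketAlgebra 2 (fun b => (σ.localFields 2).k (e b))) ''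
            (realPrimePacketWith 2 (σ.localFields 2) c hc0 hcσ).pilotRegion t j e)) ≤
      (realPrimePacketWith 2 (σ.localFields 2) c hc0 hcσ).negLogThetaPerImageAt lstar t -
        (1 / (lstar : ℝ)) *
          (((∑ j, (residueDegree 2 (DFac 2 (fun b => (σ.localFields 2).k (e₁ b)) j) : ℝ)) /
              packetDegree 2 (DFac 2 (fun b => (σ.localFields 2).k (e₁ b))) * Real.log 2) *
            ∏ b, weight F₀ (e₁ b).1) := by
  unfold PrimePacket.negLogThetaPerImageAt
  refine lnνLp_le_sub_of_succ (realPrimePacketWith 2 (σ.localFields 2) c hc0 hcσ) lstar (fun i e => ⟨?_, ?_, ?_⟩) i₁ e₁ ?_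
  · exact realPrimePacketWith_packetAdm_hull_orbitH 2 (σ.localFields 2) c hc0 hcσ t i e (H _ e) (hH _ e)
  · obtain ⟨m, -, -, -, hadm, -⟩ := realPrimePacketWith_exists_content_logμ_slotImagesHull 2 (σ.localFields 2) c hc0 hcσ t i e
    exact hadm
  · exact packetHull_mono 2 _ (realPrimePacketWith_orbitH_subset_slotImages 2 (σ.localFields 2) c hc0 hcσ t i e (H _ e) (hH _ e))
  · -- the special summand: §3 at `v⃗₁`, read against the content identity for the container's summand
    have hι : ∀ b, (RescaledCompletion.of K 2 (σ.lift (e₁ b).1) (σ.natCast_mem_lift (e₁ b))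
        (algebraMap K ((σ.lift (e₁ b).1).adicCompletion K) s)) ^ 2 = -1 :=
      fun b => sq_of_algebraMap_eq_neg_one' (σ.lift (e₁ b).1) (σ.natCast_mem_lift (e₁ b)) hs
    have hef := fun b => absRamificationIdx_eq_two_and_residueDegree_eq_one_of_localDeg_eq_two (σ.lift (e₁ b).1)
      (σ.natCast_mem_lift (e₁ b)) (hι b) (hd (e₁ b))
    have hϖex := fun b => exists_isUniformizer (F := (σ.localFields 2).k (e₁ b))
    choose ϖ hϖ using hϖex
    show packetLogμ 2 (fun b => (σ.localFields 2).k (e₁ b)) _ ≤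
      packetLogμ 2 (fun b => (σ.localFields 2).k (e₁ b))
        ((realPrimePacketWith 2 (σ.localFields 2) c hc0 hcσ).slotImagesHull
          ((realPrimePacketWith 2 (σ.localFields 2) c hc0 hcσ).pilotRegion t) ((i₁ : ℕ) + 1) e₁) - _
    obtain ⟨m, hm, -, hhull, -, -⟩ := realPrimePacketWith_exists_content_logμ_slotImagesHull 2 (σ.localFields 2) c hc0 hcσ t i₁ e₁
    rw [hhull, realPrimePacketWith_pilotRegion_succ_eq]
    exact (packetLogμ_packetHull_orbitH_le_container_sub_of_dyadicSqrtNegOne (fun b => σ.lift (e₁ b).1)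
      (fun b => σ.natCast_mem_lift (e₁ b)) hι (fun b => (hef b).1) (fun b => (hef b).2) hϖ (zero_ne_last i₁) (Fin.last _)
      (t i₁ (e₁ (Fin.last _))).ne_zero hm (H _ e₁) (hH _ e₁) hHfac).2

/-- **Hence STRICTLY below `−|log(Θ)|^{(P)}_2`** (every `Pr(v) > 0`, `ℓ⋆ ≥ 1`, the margin `(Σ_j f_j/D)·log 2 > 0`): under the hypotheses of
`…_le_negLogThetaPerImageAt_sub_of_dyadicSqrtNegOne`, `ln ν̄_{𝕃_2}(reading (P) over H) < −|log(Θ)|^{(P)}_2` — for EVERY Θ-idele `t`.  With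
abc-iut-c312-d1's `realPrimePacketWith_lnνLp_hull_orbitH_le_negLogThetaPerImageAt` (always `≤`) and R32's localisation: over such a field the `p = 2`
summand identity of the tame dichotomy NEVER holds AS TYPED. [claim: Mochizuki2012, status: disputed]
[cite: Mochizuki2012, IUTchIII Thm. 3.11 (i) p. 154; Cor. 3.12 p. 174, proof Step (x) p. 181] [cite: DupuyHilado2025, Def. 3.6.3, §4.9, §4.12] -/
theorem localFields_lnνLp_hull_orbitH_lt_negLogThetaPerImageAt_of_dyadicSqrtNegOne {s : K} (hs : s ^ 2 = -1)
    (hd : ∀ w : placesOver F₀ 2, localDeg K (σ.lift w.1) = 2) {lstar : ℕ}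
    (t : Fin lstar → (v : placesOver F₀ 2) → ((σ.localFields 2).k v)ˣ)
    (H : (j : ℕ) → (e : Fin (j + 1) → placesOver F₀ 2) →
      Subgroup (PacketAlgebra 2 (fun b => (σ.localFields 2).k (e b)) ≃ₗ[ℚ_[2]]
        PacketAlgebra 2 (fun b => (σ.localFields 2).k (e b))))
    (hH : ∀ j e, H j e ≤ indTwo 2 (fun b => (σ.localFields 2).k (e b)))
    (i₁ : Fin lstar) (e₁ : Fin ((i₁ : ℕ) + 1 + 1) → placesOver F₀ 2)
    (hHfac : ∀ γ ∈ H ((i₁ : ℕ) + 1) e₁, ∃ δ : Π b, AddAut ((σ.lift (e₁ b).1).adicCompletion K),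
      (∀ b, δ b ∈ AddSubgroup.closure (G := AddAut ((σ.lift (e₁ b).1).adicCompletion K))
        (ind1StripOf (σ.lift (e₁ b).1) (galoisLog (σ.lift (e₁ b).1)))) ∧
      ∀ z : Π b, (σ.localFields 2).k (e₁ b),
        (γ : PacketAlgebra 2 (fun b => (σ.localFields 2).k (e₁ b)) ≃ₗ[ℚ_[2]]
            PacketAlgebra 2 (fun b => (σ.localFields 2).k (e₁ b))) (PiTensorProduct.tprod ℚ_[2] z) =
          PiTensorProduct.tprod ℚ_[2] (fun b => RescaledCompletion.of K 2 (σ.lift (e₁ b).1) (σ.natCast_mem_lift (e₁ b))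
            (δ b ((RescaledCompletion.of K 2 (σ.lift (e₁ b).1) (σ.natCast_mem_lift (e₁ b))).symm (z b))))) :
    (realPrimePacketWith 2 (σ.localFields 2) c hc0 hcσ).lnνLp lstar (fun j e =>
        packetHull 2 (fun b => (σ.localFields 2).k (e b))
          (⋃ g : H j e, (g : PacketAlgebra 2 (fun b => (σ.localFields 2).k (e b)) ≃ₗ[ℚ_[2]]
              PacketAlgebra 2 (fun b => (σ.localFields 2).k (e b))) ''
            (realPrimePacketWith 2 (σ.localFields 2) c hc0 hcσ).pilotRegion t j e)) <
      (realPrimePacketWith 2 (σ.localFields 2) c hc0 hcσ).negLogThetaPerImageAt lstar t := by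
  have hle := localFields_lnνLp_hull_orbitH_le_negLogThetaPerImageAt_sub_of_dyadicSqrtNegOne σ c hc0 hcσ hs hd t H hH i₁ e₁ hHfac
  haveI : Nonempty (Fin ((i₁ : ℕ) + 1 + 1)) := ⟨Fin.last _⟩
  have hmar := margin_pos 2 (fun b => (σ.localFields 2).k (e₁ b))
  have hl : (0 : ℝ) < 1 / (lstar : ℝ) := by
    have : 0 < lstar := lt_of_le_of_lt (Nat.zero_le _) i₁.2
    positivity
  have hw : 0 < ∏ b, weight F₀ (e₁ b).1 := by
    refine Finset.prod_pos fun b _ => ?_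
    unfold weight
    have h1 : (0 : ℝ) < localDegree F₀ (e₁ b).1 := by exact_mod_cast localDegree_pos F₀ (e₁ b).1
    have h2 : (0 : ℝ) < Module.finrank ℚ F₀ := by exact_mod_cast Module.finrank_pos
    exact div_pos h1 h2
  have hpos : 0 < (1 / (lstar : ℝ)) *
      (((∑ j, (residueDegree 2 (DFac 2 (fun b => (σ.localFields 2).k (e₁ b)) j) : ℝ)) /
          packetDegree 2 (DFac 2 (fun b => (σ.localFields 2).k (e₁ b))) * Real.log 2) *
        ∏ b, weight F₀ (e₁ b).1) := mul_pos hl (mul_pos hmar hw)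
  linarith

/-- **THE `p = 2` SUMMAND IDENTITY NEVER HOLDS AS TYPED** (`ℓ⋆ ≥ 1`; `K ∋ √−1`, every place of the section over `2` of local degree `2`): for EVERY
Θ-idele `t` and EVERY family `H_{j,v⃗} ≤ indTwo` acting factorwise through the realised strip groups at every collection,
`ln ν̄_{𝕃_2}(reading (P) over H) ≠ −|log(Θ)|^{(P)}_2` — the left side of R30 §2's displayed equivalence at `p = 2`, with NO room condition and NO
Jannsen–Wingberg / Diekert–Nishio binder.  Which Θ-regions an actual Θ-datum presents is irrelevant here: the strict drop holds for all of them.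
[claim: Mochizuki2012, status: disputed] [cite: Mochizuki2012, IUTchIII Thm. 3.11 (i) p. 154; Cor. 3.12 p. 174, proof Step (x) p. 181]
[cite: DupuyHilado2025, Def. 3.6.3, §4.9, §4.12] -/
theorem localFields_lnνLp_hull_orbitH_ne_negLogThetaPerImageAt_of_dyadicSqrtNegOne {s : K} (hs : s ^ 2 = -1)
    (hd : ∀ w : placesOver F₀ 2, localDeg K (σ.lift w.1) = 2) {lstar : ℕ} (hl : 0 < lstar)
    (t : Fin lstar → (v : placesOver F₀ 2) → ((σ.localFields 2).k v)ˣ)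
    (H : (j : ℕ) → (e : Fin (j + 1) → placesOver F₀ 2) →
      Subgroup (PacketAlgebra 2 (fun b => (σ.localFields 2).k (e b)) ≃ₗ[ℚ_[2]]
        PacketAlgebra 2 (fun b => (σ.localFields 2).k (e b))))
    (hH : ∀ j e, H j e ≤ indTwo 2 (fun b => (σ.localFields 2).k (e b)))
    (hHfac : ∀ (i : Fin lstar) (e : Fin ((i : ℕ) + 1 + 1) → placesOver F₀ 2), ∀ γ ∈ H ((i : ℕ) + 1) e,
      ∃ δ : Π b, AddAut ((σ.lift (e b).1).adicCompletion K),
        (∀ b, δ b ∈ AddSubgroup.closure (G := AddAut ((σ.lift (e b).1).adicCompletion K))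
          (ind1StripOf (σ.lift (e b).1) (galoisLog (σ.lift (e b).1)))) ∧
        ∀ z : Π b, (σ.localFields 2).k (e b),
          (γ : PacketAlgebra 2 (fun b => (σ.localFields 2).k (e b)) ≃ₗ[ℚ_[2]]
              PacketAlgebra 2 (fun b => (σ.localFields 2).k (e b))) (PiTensorProduct.tprod ℚ_[2] z) =
            PiTensorProduct.tprod ℚ_[2] (fun b => RescaledCompletion.of K 2 (σ.lift (e b).1) (σ.natCast_mem_lift (e b))
              (δ b ((RescaledCompletion.of K 2 (σ.lift (e b).1) (σ.natCast_mem_lift (e b))).symm (z b))))) :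
    (realPrimePacketWith 2 (σ.localFields 2) c hc0 hcσ).lnνLp lstar (fun j e =>
        packetHull 2 (fun b => (σ.localFields 2).k (e b))
          (⋃ g : H j e, (g : PacketAlgebra 2 (fun b => (σ.localFields 2).k (e b)) ≃ₗ[ℚ_[2]]
              PacketAlgebra 2 (fun b => (σ.localFields 2).k (e b))) ''
            (realPrimePacketWith 2 (σ.localFields 2) c hc0 hcσ).pilotRegion t j e)) ≠
      (realPrimePacketWith 2 (σ.localFields 2) c hc0 hcσ).negLogThetaPerImageAt lstar t := by
  obtain ⟨w₀⟩ : Nonempty (placesOver F₀ 2) := let ⟨v, hv⟩ := placesOver_nonempty F₀ 2; ⟨⟨v, hv⟩⟩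
  exact (localFields_lnνLp_hull_orbitH_lt_negLogThetaPerImageAt_of_dyadicSqrtNegOne σ c hc0 hcσ hs hd t H hH ⟨0, hl⟩ (fun _ => w₀)
    (hHfac ⟨0, hl⟩ (fun _ => w₀))).ne

end PlaceSection

end Summit.ABC.IUTFork.Thm311.Real

end
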